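import Summits.QuantumFields.QCD.Theses.NestedDissectionSea
import Summits.QuantumFields.QCD.Theorems.CoerciveSea.Negative.CellDeterminants

/-!
# Route `NestedDissectionSea` — support item `SignDefectForcesCrossing` (stmt-QuantumFields-13898)

The first lemma of the early-crosser mechanism: a SIGN DEFECT of the corner-`0` box of sides `s`
at bare mass `μ` (leaf scale `j = 0`: `Re det` of its Dirichlet cell is negative; `j ≥ 1`: the
product of the parent's and the sixteen children's `Re det` is negative) forces a ZERO MODE of one
of the cells `{parent, 16 children}` at some bare mass `μ' ≥ μ` — a real eigenvalue of the massless
Dirichlet Wilson cell operator has crossed at or above `μ`.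

Proof (as planned in the item): for a fixed cell `(x, s)` the map `t ↦ Re det D_c(U, t)` is
continuous (the entries of `wilsonCell U t x s` are affine in `t`, `Continuous.matrix_det`), it is
positive at `t = max μ 1` (`cellDetRe_pos`: Dirichlet cell determinants are positive off the
hopping band `|t + 4| ≤ 4`, landed in `CoerciveSea/Negative/CellDeterminants`), so a negative value
at `μ` gives a zero of `Re det` on `[μ, max μ 1]` by the intermediate value theorem; the determinant
is real (`det_wilsonCell_im`, γ₅-hermiticity restricted to the box), hence vanishes there. A
negative product of seventeen reals has a negative factor (`Finset.prod_nonneg`), which reduces the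
scale-`j ≥ 1` case to the single-cell lemma for the parent or for a child
`(halfCorner s ε, halfSides s ε)`.

Contents: `continuous_wilsonCell_mass`, `continuous_cellDetRe_mass` (continuity in the bare mass),
`exists_det_wilsonCell_eq_zero_of_cellDetRe_neg` (single-cell crossing lemma), and the closing
theorem `signDefectForcesCrossing_proof` (type = the route decl verbatim).
-/

noncomputable section

open scoped BigOperators Topology
open Filter Set Matrix
open Literature.MathematicalPhysics.QuantumLattice Literature.MathematicalPhysics.QuantumFieldTheory
  Literature.Probability.LatticeModels
open Summit.QuantumFields.QCD.Theorems.CoerciveSeaNegative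

namespace Summit.QuantumFields.QCD.Theorems

namespace NestedDissectionSea

variable {N : ℕ} [NeZero N]

omit [NeZero N] in
/-- The Dirichlet cell matrix `wilsonCell U t x s` depends continuously on the bare mass `t`: its
entries are those of `D_W(U, t, 1)`, i.e. `t + 4` on the diagonal and `t`-independent hopping terms
off it. [folklore] -/
theorem continuous_wilsonCell_mass (U : GaugeConfig 4 N (Matrix.specialUnitaryGroup (Fin 3) ℂ))
    (x : TorusSite 4 N) (s : Fin 4 → ℕ) :
    Continuous fun t : ℝ => wilsonCell U t x s := by
  refine continuous_matrix fun i j => ?_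
  simp only [wilsonCell, toSquareBlockProp_def, Matrix.of_apply, wilsonDirac]
  refine Continuous.sub ?_ continuous_const
  split_ifs
  · exact Complex.continuous_ofReal.comp (continuous_id.add continuous_const)
  · exact continuous_const

/-- `t ↦ Re det D_c(U, t)` is continuous in the bare mass `t` (a polynomial in `t`). [folklore] -/
theorem continuous_cellDetRe_mass (U : GaugeConfig 4 N (Matrix.specialUnitaryGroup (Fin 3) ℂ))
    (x : TorusSite 4 N) (s : Fin 4 → ℕ) :
    Continuous fun t : ℝ => cellDetRe U t x s := by
  simp only [cellDetRe_eq]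
  exact Complex.continuous_re.comp (continuous_wilsonCell_mass U x s).matrix_det

/-- **Single-cell crossing lemma.** If the Dirichlet cell `(x, s)` has `Re det D_c(U, μ) < 0`, then
`det D_c(U, μ') = 0` for some `μ' ≥ μ` (indeed `μ' ∈ [μ, max μ 1]`): `Re det` is continuous in the
mass, positive at `max μ 1` (off the hopping band, `cellDetRe_pos`), so it vanishes in between by
the intermediate value theorem, and the determinant is real (`det_wilsonCell_im`). [folklore] -/
theorem exists_det_wilsonCell_eq_zero_of_cellDetRe_neg
    (U : GaugeConfig 4 N (Matrix.specialUnitaryGroup (Fin 3) ℂ)) {μ : ℝ} (x : TorusSite 4 N)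
    (s : Fin 4 → ℕ) (h : cellDetRe U μ x s < 0) :
    ∃ μ' : ℝ, μ ≤ μ' ∧ (wilsonCell U μ' x s).det = 0 := by
  have hμT : μ ≤ max μ 1 := le_max_left _ _
  have h1T : (1 : ℝ) ≤ max μ 1 := le_max_right _ _
  have hband : 4 < |max μ 1 + 4| := by
    rw [abs_of_pos (by linarith)]
    linarith
  have hpos : 0 < cellDetRe U (max μ 1) x s := cellDetRe_pos U hband x s
  have hmem : (0 : ℝ) ∈ Set.Icc (cellDetRe U μ x s) (cellDetRe U (max μ 1) x s) := ⟨h.le, hpos.le⟩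
  obtain ⟨μ', hμ', h0⟩ :=
    intermediate_value_Icc hμT (continuous_cellDetRe_mass U x s).continuousOn hmem
  refine ⟨μ', hμ'.1, Complex.ext ?_ ?_⟩
  · simpa [cellDetRe_eq] using h0
  · simpa using det_wilsonCell_im U μ' x s

end NestedDissectionSea

open NestedDissectionSea in
/-- **`SignDefectForcesCrossing` holds** (route `NestedDissectionSea`, item stmt-QuantumFields-13898):
if the corner-`0` box of sides `s` is a sign defect at bare mass `μ` and scale `j`
(`IsSignDefect U μ j s`), then the parent cell or one of its sixteen children
`(halfCorner s ε, halfSides s ε)` has a zero mode (`det wilsonCell = 0`) at some bare mass `μ' ≥ μ`.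
At `j = 0` the parent's `Re det` is negative; at `j ≥ 1` the product parent × children is negative,
so either the parent's `Re det` is negative or (parent `≥ 0`, `Finset.prod_nonneg`) some child's
is; in each case the single-cell crossing lemma
`exists_det_wilsonCell_eq_zero_of_cellDetRe_neg` concludes. -/
theorem signDefectForcesCrossing_proof :
    Summit.QuantumFields.QCD.Theses.NestedDissectionSea.SignDefectForcesCrossing := by
  intro N _ U μ j s h
  rcases h with ⟨-, h0⟩ | ⟨-, hprod⟩
  · obtain ⟨μ', hμ', hdet⟩ := exists_det_wilsonCell_eq_zero_of_cellDetRe_neg U 0 s h0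
    exact ⟨μ', hμ', Or.inl hdet⟩
  · by_cases hpar : cellDetRe U μ 0 s < 0
    · obtain ⟨μ', hμ', hdet⟩ := exists_det_wilsonCell_eq_zero_of_cellDetRe_neg U 0 s hpar
      exact ⟨μ', hμ', Or.inl hdet⟩
    · have hex : ¬ ∀ ε : Fin 4 → Bool, 0 ≤ cellDetRe U μ (halfCorner s ε) (halfSides s ε) :=
        fun hall => absurd hprod
          (not_lt.mpr (mul_nonneg (not_lt.mp hpar) (Finset.prod_nonneg fun ε _ => hall ε)))
      obtain ⟨ε, hε⟩ := not_forall.mp hex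
      obtain ⟨μ', hμ', hdet⟩ :=
        exists_det_wilsonCell_eq_zero_of_cellDetRe_neg U (halfCorner s ε) (halfSides s ε)
          (not_le.mp hε)
      exact ⟨μ', hμ', Or.inr ⟨ε, hdet⟩⟩

end Summit.QuantumFields.QCD.Theorems

end
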